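import Literature.NumberTheory.LFunctions.Zhang2022.ObjectiveTwinDetTwoTerm

/-!
# Zhang (2022) design-space objective, twin part 18c: the full-gap EDGE witness for EVERY `J` — closed form and
# the limit `−(4+π)`

Y. Zhang, *Discrete mean estimates and the Landau–Siegel zero*, arXiv:2211.02515v1 (2022)
[Zhang2022LandauSiegel] — an unrefereed manuscript under adjudication. **This file SEARCHES and TYPES; it
makes no claim about Landau–Siegel zeros, about Theorems 1–2 of the manuscript, or about a repaired (2.32),
until a kernel theorem says so.** LANDAU–SIEGEL programme, cell `landau-siegel`, §A Lean twin serving §D (edge ell):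
ls-Bmulti-num-1 g4's conjecture (cell INBOX 2026-08-27T01:20:50Z) that the certified two-term edge witness values
`FormDet(shiftRecipe(1, J−½, J+½))(k₁ ± k_J)` tend to `−(4+π)`.

With part 18's `Det.formDet_recipe_twoTerm` (`p = 1`, `q = J`) and the recipe data of `b = (1, J−½, J+½)` in closed
form (`Det.shiftW_fullGap`: `W = (−i(−1)^J/((J−3/2)(J−½)), (J−½)/(J−3/2), (J+½)/(J−½))`):

* `Det.formDet_fullGapEdge_even` — `J` even, `J ≥ 2`, witness `k₁ + k_J`:
  `FormDet = −4 − π − π/(J(2J−1)(2J−3))`;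
* `Det.formDet_fullGapEdge_odd` — `J` odd, `J ≥ 3`, witness `k₁ − k_J`:
  `FormDet = −4 − 4/(J²(2J−3)) − π − π/(J(2J−1)(2J−3))` (`J = 3`: `−112/27 − 46π/45`, part 16);
* `Det.tendsto_formDet_fullGapEdge` — along `J → ∞` the values tend to `−(4 + π)` (both parities; stated for the
  parity-uniform expression `−4 − π − π/(J(2J−1)(2J−3)) − (1 − (−1)^J)·2/(J²(2J−3))`).

SCOPE: `b₀ = 1` is the INADMISSIBLE edge; this is the exact shape of the numerics' «J-stable edge value», nothing about
admissible designs. Theorems only; no new definitions.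
-/

noncomputable section

open Complex Real ComplexConjugate Filter Topology

namespace Literature.NumberTheory.LFunctions.Zhang2022

namespace Det

open Repair Objective

/-! ## Helpers -/

/-- `x / c_j = x·(1/(jπ))·i`. [folklore] -/
private theorem div_afeFreq₁₈c (x : ℂ) {j : ℕ} (hj : j ≠ 0) :
    x / afeFreq j = x * (((1 / (j * π)) : ℝ) : ℂ) * Complex.I := by
  have hc := afeFreq_ne_zero hj
  rw [div_eq_iff hc]
  unfold afeFreq
  push_cast
  have hπ : (π : ℂ) ≠ 0 := Complex.ofReal_ne_zero.mpr Real.pi_ne_zero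
  have hjc : (j : ℂ) ≠ 0 := Nat.cast_ne_zero.mpr hj
  field_simp
  ring_nf
  rw [Complex.I_sq]
  ring

/-- `1/c_j = (1/(jπ))·i`. [folklore] -/
private theorem afeFreq_inv₁₈c {j : ℕ} (hj : j ≠ 0) :
    (afeFreq j)⁻¹ = (((1 / (j * π)) : ℝ) : ℂ) * Complex.I := by
  rw [inv_eq_one_div, div_afeFreq₁₈c 1 hj, one_mul]

/-- `c_j = −(jπ)·i`. [folklore] -/
private theorem afeFreq_eq₁₈c (j : ℕ) : afeFreq j = ((-(j * π) : ℝ) : ℂ) * Complex.I := by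
  unfold afeFreq; push_cast; ring

/-- `e^{iπ(J − ½)} = −i·(−1)^J`. [folklore] -/
private theorem cexp_pi_mul_sub_half (J : ℕ) :
    cexp (I * π * (((J : ℝ) - 1 / 2 : ℝ) : ℂ)) = -I * (-1) ^ J := by
  rw [show I * π * (((J : ℝ) - 1 / 2 : ℝ) : ℂ) = (J : ℂ) * (π * I) + (-(π / 2) : ℂ) * I by push_cast; ring,
    Complex.exp_add, Complex.exp_nat_mul, Complex.exp_pi_mul_I, Complex.exp_mul_I, Complex.cos_neg, Complex.sin_neg,
    Complex.cos_pi_div_two, Complex.sin_pi_div_two]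
  ring

/-! ## The recipe `shiftRecipe (1, J−½, J+½)` in closed form -/

/-- `s(1, J−½, J+½) = (2J, J+3/2, J+½)`. [cite: Zhang2022LandauSiegel, §8 (8.13)–(8.18)] -/
theorem shiftS_fullGap (J : ℕ) :
    shiftS ![1, (J : ℝ) - 1 / 2, (J : ℝ) + 1 / 2] = ![2 * (J : ℝ), (J : ℝ) + 3 / 2, (J : ℝ) + 1 / 2] := by
  funext j; fin_cases j <;> (simp [shiftS]; try ring)

/-- `n(1, J−½, J+½) = (J² − ¼, J+½, J−½)`. [cite: Zhang2022LandauSiegel, §8 (8.13)–(8.18)] -/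
theorem shiftN_fullGap (J : ℕ) :
    shiftN ![1, (J : ℝ) - 1 / 2, (J : ℝ) + 1 / 2] = ![(J : ℝ) ^ 2 - 1 / 4, (J : ℝ) + 1 / 2, (J : ℝ) - 1 / 2] := by
  funext j; fin_cases j <;> (simp [shiftN]; try ring)

/-- **`W(1, J−½, J+½) = (−i(−1)^J/((J−3/2)(J−½)), (J−½)/(J−3/2), (J+½)/(J−½))`** (phases `e^{iπ(J−½)} = −i(−1)^J`,
`e^{iπ} = −1`, `1`). [cite: Zhang2022LandauSiegel, proof of Prop 7.1, (7.19)–(7.21)] -/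
theorem shiftW_fullGap (J : ℕ) :
    shiftW ![1, (J : ℝ) - 1 / 2, (J : ℝ) + 1 / 2] =
      ![-I * (-1) ^ J / ((((J : ℝ) - 3 / 2) * ((J : ℝ) - 1 / 2) : ℝ) : ℂ),
        ((((J : ℝ) - 1 / 2) / ((J : ℝ) - 3 / 2) : ℝ) : ℂ),
        ((((J : ℝ) + 1 / 2) / ((J : ℝ) - 1 / 2) : ℝ) : ℂ)] := by
  funext j
  fin_cases j
  · simp only [shiftW, shiftS, shiftVdm]
    simp only [Fin.zero_eta, Fin.isValue, Matrix.cons_val_zero, Matrix.cons_val_one, Matrix.head_cons,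
      Matrix.cons_val_two, Matrix.tail_cons]
    rw [show (((J : ℝ) - 1 / 2 + ((J : ℝ) + 1 / 2) - 1) / 2 : ℝ) = (J : ℝ) - 1 / 2 by ring, cexp_pi_mul_sub_half]
    push_cast
    ring
  · simp only [shiftW, shiftS, shiftVdm]
    simp only [Fin.mk_one, Fin.isValue, Matrix.cons_val_zero, Matrix.cons_val_one, Matrix.head_cons,
      Matrix.cons_val_two, Matrix.tail_cons]
    have h : cexp (I * π * ((((J : ℝ) + 1 / 2 + 1 - ((J : ℝ) - 1 / 2)) / 2 : ℝ) : ℂ)) = -1 := by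
      rw [show ((((J : ℝ) + 1 / 2 + 1 - ((J : ℝ) - 1 / 2)) / 2 : ℝ) : ℂ) = 1 by push_cast; ring,
        show I * π * 1 = π * I by ring, Complex.exp_pi_mul_I]
    rw [h]; push_cast
    rw [show ((J : ℂ) + 1 / 2 - ((J : ℂ) - 1 / 2)) * (1 - ((J : ℂ) - 1 / 2)) = -((J : ℂ) - 3 / 2) by ring,
      mul_neg_one, neg_div_neg_eq]
  · simp only [shiftW, shiftS, shiftVdm]
    simp only [Fin.reduceFinMk, Fin.isValue, Matrix.cons_val_zero, Matrix.cons_val_one, Matrix.head_cons,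
      Matrix.cons_val_two, Matrix.tail_cons]
    have h : cexp (I * π * (((1 + ((J : ℝ) - 1 / 2) - ((J : ℝ) + 1 / 2)) / 2 : ℝ) : ℂ)) = 1 := by
      rw [show (((1 + ((J : ℝ) - 1 / 2) - ((J : ℝ) + 1 / 2)) / 2 : ℝ) : ℂ) = 0 by push_cast; ring, mul_zero,
        Complex.exp_zero]
    rw [h]; push_cast; ring

/-! ## Even `J`: witness `k₁ + k_J` -/

/-- **THE FULL-GAP EDGE VALUE, EVEN `J ≥ 2`**: `FormDet (shiftRecipe (1, J−½, J+½)) (k₁ + k_J) =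
−4 − π − π/(J(2J−1)(2J−3))`. [cite: Zhang2022LandauSiegel, Prop 7.1 p.44 with (8.11)–(8.23); §2 (2.13)] -/
theorem formDet_fullGapEdge_even {J : ℕ} (hJ : Even J) (hJ2 : 2 ≤ J) :
    FormDet (shiftRecipe ![1, (J : ℝ) - 1 / 2, (J : ℝ) + 1 / 2]) (fun y => (1:ℂ) * afeDir 1 y + 1 * afeDir J y)
        (fun y => (1:ℂ) * afeDir' 1 y + 1 * afeDir' J y) =
      -4 - π - π / ((J : ℝ) * (2 * J - 1) * (2 * J - 3)) := by
  have hJ1 : 1 < J := by omega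
  have hJne : J ≠ 0 := by omega
  have hJm1 : J - 1 ≠ 0 := by omega
  have hpow : (-1 : ℂ) ^ J = 1 := hJ.neg_one_pow
  have hpow1 : (-1 : ℂ) ^ (J - 1) = -1 := by
    have h := pow_succ (-1 : ℂ) (J - 1)
    rw [Nat.sub_add_cancel hJ1.le, hpow] at h
    linear_combination h
  have h1 : (1:ℂ) * (-1) ^ 1 + 1 * (-1) ^ J = 0 := by rw [hpow]; norm_num
  rw [formDet_recipe_twoTerm _ one_ne_zero hJ1 1 1 h1]
  simp only [shiftRecipe, shiftW_fullGap, shiftS_fullGap, shiftN_fullGap, Fin.sum_univ_three]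
  simp only [Fin.isValue, Matrix.cons_val_zero, Matrix.cons_val_one, Matrix.head_cons, Matrix.cons_val_two,
    Matrix.tail_cons]
  rw [hpow, hpow1]
  simp only [pow_one, div_eq_mul_inv, afeFreq_inv₁₈c one_ne_zero, afeFreq_inv₁₈c hJne, afeFreq_inv₁₈c hJm1]
  simp only [afeFreq_eq₁₈c]
  have hcast : ((J - 1 : ℕ) : ℝ) = (J : ℝ) - 1 := by push_cast [Nat.cast_sub hJ1.le]; ring
  simp only [hcast]
  have hπ : π ≠ 0 := Real.pi_ne_zero
  have hJr : (J : ℝ) ≠ 0 := Nat.cast_ne_zero.mpr hJne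
  have hJr1 : (J : ℝ) - 1 ≠ 0 := by
    have : (2:ℝ) ≤ J := by exact_mod_cast hJ2
    linarith
  have hJr2 : (J : ℝ) - 3 / 2 ≠ 0 := by
    intro h
    have : (2 : ℝ) * J = 3 := by linarith
    have h2 : (2 * J : ℕ) = 3 := by exact_mod_cast this
    omega
  have hJr3 : (J : ℝ) - 1 / 2 ≠ 0 := by
    intro h
    have : (2 : ℝ) * J = 1 := by linarith
    have h2 : (2 * J : ℕ) = 1 := by exact_mod_cast this
    omega
  have hJr4 : (2 : ℝ) * J - 1 ≠ 0 := by
    intro h; apply hJr3; linarith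
  have hJr5 : (2 : ℝ) * J - 3 ≠ 0 := by
    intro h; apply hJr2; linarith
  simp only [map_add, map_mul, map_sub, map_neg, map_one, Complex.conj_ofReal, Complex.conj_I,
    Complex.add_re, Complex.add_im, Complex.sub_re, Complex.sub_im, Complex.mul_re, Complex.mul_im,
    Complex.neg_re, Complex.neg_im, Complex.I_re, Complex.I_im, Complex.ofReal_re, Complex.ofReal_im,
    Complex.one_re, Complex.one_im, Complex.inv_re, Complex.inv_im, Complex.normSq_ofReal]
  push_cast
  field_simp
  ring

/-! ## Odd `J`: witness `k₁ − k_J` -/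

/-- **THE FULL-GAP EDGE VALUE, ODD `J ≥ 3`**: `FormDet (shiftRecipe (1, J−½, J+½)) (k₁ − k_J) =
−4 − 4/(J²(2J−3)) − π − π/(J(2J−1)(2J−3))` (`J = 3`: `−112/27 − 46π/45`, part 16).
[cite: Zhang2022LandauSiegel, Prop 7.1 p.44 with (8.11)–(8.23); §2 (2.13)] -/
theorem formDet_fullGapEdge_odd {J : ℕ} (hJ : Odd J) (hJ3 : 3 ≤ J) :
    FormDet (shiftRecipe ![1, (J : ℝ) - 1 / 2, (J : ℝ) + 1 / 2]) (fun y => (1:ℂ) * afeDir 1 y + (-1) * afeDir J y)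
        (fun y => (1:ℂ) * afeDir' 1 y + (-1) * afeDir' J y) =
      -4 - 4 / ((J : ℝ) ^ 2 * (2 * J - 3)) - π - π / ((J : ℝ) * (2 * J - 1) * (2 * J - 3)) := by
  have hJ1 : 1 < J := by omega
  have hJne : J ≠ 0 := by omega
  have hJm1 : J - 1 ≠ 0 := by omega
  have hpow : (-1 : ℂ) ^ J = -1 := hJ.neg_one_pow
  have hpow1 : (-1 : ℂ) ^ (J - 1) = 1 := by
    have h := pow_succ (-1 : ℂ) (J - 1)
    rw [Nat.sub_add_cancel hJ1.le, hpow] at h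
    linear_combination h
  have h1 : (1:ℂ) * (-1) ^ 1 + (-1) * (-1) ^ J = 0 := by rw [hpow]; norm_num
  rw [formDet_recipe_twoTerm _ one_ne_zero hJ1 1 (-1) h1]
  simp only [shiftRecipe, shiftW_fullGap, shiftS_fullGap, shiftN_fullGap, Fin.sum_univ_three]
  simp only [Fin.isValue, Matrix.cons_val_zero, Matrix.cons_val_one, Matrix.head_cons, Matrix.cons_val_two,
    Matrix.tail_cons]
  rw [hpow, hpow1]
  simp only [pow_one, div_eq_mul_inv, afeFreq_inv₁₈c one_ne_zero, afeFreq_inv₁₈c hJne, afeFreq_inv₁₈c hJm1]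
  simp only [afeFreq_eq₁₈c]
  have hcast : ((J - 1 : ℕ) : ℝ) = (J : ℝ) - 1 := by push_cast [Nat.cast_sub hJ1.le]; ring
  simp only [hcast]
  have hπ : π ≠ 0 := Real.pi_ne_zero
  have hJr : (J : ℝ) ≠ 0 := Nat.cast_ne_zero.mpr hJne
  have hJr1 : (J : ℝ) - 1 ≠ 0 := by
    have : (3:ℝ) ≤ J := by exact_mod_cast hJ3
    linarith
  have hJr2 : (J : ℝ) - 3 / 2 ≠ 0 := by
    intro h
    have : (2 : ℝ) * J = 3 := by linarith
    have h2 : (2 * J : ℕ) = 3 := by exact_mod_cast this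
    omega
  have hJr3 : (J : ℝ) - 1 / 2 ≠ 0 := by
    intro h
    have : (2 : ℝ) * J = 1 := by linarith
    have h2 : (2 * J : ℕ) = 1 := by exact_mod_cast this
    omega
  have hJr4 : (2 : ℝ) * J - 1 ≠ 0 := by
    intro h; apply hJr3; linarith
  have hJr5 : (2 : ℝ) * J - 3 ≠ 0 := by
    intro h; apply hJr2; linarith
  simp only [map_add, map_mul, map_sub, map_neg, map_one, Complex.conj_ofReal, Complex.conj_I,
    Complex.add_re, Complex.add_im, Complex.sub_re, Complex.sub_im, Complex.mul_re, Complex.mul_im,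
    Complex.neg_re, Complex.neg_im, Complex.I_re, Complex.I_im, Complex.ofReal_re, Complex.ofReal_im,
    Complex.one_re, Complex.one_im, Complex.inv_re, Complex.inv_im, Complex.normSq_ofReal]
  push_cast
  field_simp
  ring

/-! ## The limit `−(4 + π)` -/

/-- **The edge values tend to `−(4+π)`**: the parity-uniform closed form
`f(J) = −4 − π − π/(J(2J−1)(2J−3)) − (1 − (−1)^J)·2/(J²(2J−3))` (`= formDet_fullGapEdge_even/odd` for `J ≥ 3`
of the matching parity) satisfies `f(J) → −(4+π)` as `J → ∞`. [cite: Zhang2022LandauSiegel, Prop 7.1 p.44; §2 (2.13)] -/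
theorem tendsto_formDet_fullGapEdge :
    Tendsto (fun J : ℕ => -4 - π - π / ((J : ℝ) * (2 * J - 1) * (2 * J - 3))
        - (1 - (-1 : ℝ) ^ J) * (2 / ((J : ℝ) ^ 2 * (2 * J - 3)))) atTop (𝓝 (-(4 + π))) := by
  -- the two correction terms are `O(1/J)`
  have hA : Tendsto (fun J : ℕ => π / ((J : ℝ) * (2 * J - 1) * (2 * J - 3))) atTop (𝓝 0) := by
    have hb : Tendsto (fun J : ℕ => π / (J : ℝ)) atTop (𝓝 0) := tendsto_const_div_atTop_nhds_zero_nat π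
    refine squeeze_zero' ?_ ?_ hb
    · filter_upwards [eventually_ge_atTop 2] with J hJ
      have hJ' : (2:ℝ) ≤ J := by exact_mod_cast hJ
      have : 0 < (J : ℝ) * (2 * J - 1) * (2 * J - 3) := by
        have h1 : (0:ℝ) < 2 * J - 1 := by linarith
        have h2 : (0:ℝ) < 2 * J - 3 := by linarith
        positivity
      exact div_nonneg Real.pi_pos.le this.le
    · filter_upwards [eventually_ge_atTop 2] with J hJ
      have hJ' : (2:ℝ) ≤ J := by exact_mod_cast hJ
      have hJ0 : (0:ℝ) < J := by linarith
      have h1 : (1:ℝ) ≤ (2 * J - 1) * (2 * J - 3) := by nlinarith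
      rw [mul_assoc]
      exact div_le_div_of_nonneg_left Real.pi_pos.le hJ0 (by nlinarith)
  have hB : Tendsto (fun J : ℕ => (1 - (-1 : ℝ) ^ J) * (2 / ((J : ℝ) ^ 2 * (2 * J - 3)))) atTop (𝓝 0) := by
    have hb : Tendsto (fun J : ℕ => (4:ℝ) / (J : ℝ)) atTop (𝓝 0) := tendsto_const_div_atTop_nhds_zero_nat 4
    refine squeeze_zero' ?_ ?_ hb
    · filter_upwards [eventually_ge_atTop 2] with J hJ
      have hJ' : (2:ℝ) ≤ J := by exact_mod_cast hJ
      have hs : 0 ≤ 1 - (-1 : ℝ) ^ J := by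
        rcases neg_one_pow_eq_or ℝ J with h | h <;> rw [h] <;> norm_num
      have : 0 < (J : ℝ) ^ 2 * (2 * J - 3) := by
        have h2 : (0:ℝ) < 2 * J - 3 := by linarith
        positivity
      exact mul_nonneg hs (div_nonneg (by norm_num) this.le)
    · filter_upwards [eventually_ge_atTop 2] with J hJ
      have hJ' : (2:ℝ) ≤ J := by exact_mod_cast hJ
      have hJ0 : (0:ℝ) < J := by linarith
      have hs : 1 - (-1 : ℝ) ^ J ≤ 2 := by
        rcases neg_one_pow_eq_or ℝ J with h | h <;> rw [h] <;> norm_num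
      have hs0 : 0 ≤ 1 - (-1 : ℝ) ^ J := by
        rcases neg_one_pow_eq_or ℝ J with h | h <;> rw [h] <;> norm_num
      have hden : (J : ℝ) ≤ (J : ℝ) ^ 2 * (2 * J - 3) := by nlinarith
      have hdpos : 0 < (J : ℝ) ^ 2 * (2 * J - 3) := by
        have h2 : (0:ℝ) < 2 * J - 3 := by linarith
        positivity
      calc (1 - (-1 : ℝ) ^ J) * (2 / ((J : ℝ) ^ 2 * (2 * J - 3)))
          ≤ 2 * (2 / (J : ℝ)) := by
            apply mul_le_mul hs (div_le_div_of_nonneg_left (by norm_num) hJ0 hden) (by positivity) (by norm_num)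
        _ = 4 / (J : ℝ) := by ring
  have h := ((tendsto_const_nhds (x := (-4 - π : ℝ))).sub hA).sub hB
  rw [sub_zero, sub_zero] at h
  rw [show (-(4 + π) : ℝ) = -4 - π by ring]
  exact h

end Det

end Literature.NumberTheory.LFunctions.Zhang2022
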